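import Summits.RiemannHypothesis.RiemannHypothesis.Theorems.SuzukiSharpRadiusEight

/-!
# SuzukiSharpRadiusEightValue — certified enclosure `0.3203 ≤ ξ'/ξ(8) ≤ 0.3236` and the numerical corollary:
every `c ≤ 0.0427` is a linear clean radius of Suzuki's single operator (column DBR; RH-FREE)

RH-FREE throughout; nothing here bears on the truth of RH.  Companion of `Theorems.SuzukiSharpRadiusEight`
(`linear_clean_radius_eight`: every `c < (2/15)·ξ'/ξ(8)` is a linear clean radius, unconditionally).  Here the constant
is evaluated: `ξ'/ξ(8) = 1/8 + 1/7 − ½log π + ½ψ(4) − Σ Λ(n) n⁻⁸` with `ψ(4) = 11/6 − γ` (Mathlib's `digamma_one`,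
`digamma_apply_add_one`), the tree's certified `γ ∈ (0.57721558, 0.57721571)`, `log π` to 20 digits, and the elementary
tail bound `0 ≤ Σ Λ(n) n⁻⁸ ≤ log 2/256 + (log 2 + ½)/6561 + (π²/6 − 49/36)/1024 < 0.00317` (comparison series written inline; `Λ ≤ log`, `log 3 ≤ log 2 + ½`,
`log n ≤ n`, `n⁵ ≥ 1024` for `n ≥ 4`, `Σ n⁻² = π²/6`).  Hence `0.3203 ≤ ξ'/ξ(8) ≤ 0.3236` (true value `0.32066…`) and
**`CleanUpTo θ (c·θ)` for all large `θ`, for every `c ≤ 0.0427`** (`(2/15)·0.3203 = 0.04270…`; in particular every window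
`t ≤ θ/25`), about `600×` the constant `≈ 7·10⁻⁵` of `Theorems.SuzukiCleanRadius` and `92 %` of the conditional optimum
`c⋆ = 0.046191…` of `Theorems.SuzukiSharpRadiusXiAtOne`.  §4 restates everything through the named predicates of
`Theorems.SuzukiSharpRadiusDefs` (`SaddleHeightBoundAt` holds; `XiLogDerivMinOnAxisAt 8`; `LinearCleanRadiusBelow (ξ'/ξ(8)/(15/2))`,
`LinearCleanRadiusBelow 0.0427`; `LinearCleanRadiusSharp ↔ LinearCleanRadiusBelow c⋆`).
-/

noncomputable section

-- D-0017: `Summit.<S>.<S>.…` is the designed namespace of a single-problem summit.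
set_option linter.dupNamespace false

open Complex Filter Topology Set LSeries

open scoped LSeries.notation ArithmeticFunction.vonMangoldt

namespace Summit.RiemannHypothesis.RiemannHypothesis.Theorems.SuzukiSharpRadius

open Literature.NumberTheory.LFunctions Literature.Analysis.SpecialFunctions
open Summit.RiemannHypothesis.RiemannHypothesis.Theorems.SuzukiCleanRadius

/-! ## §1 `ψ(4) = 11/6 − γ` and the closed part of `ξ'/ξ(8)` -/

/-- `ψ(4) = 11/6 − γ` (`ψ(1) = −γ`, `ψ(s+1) = ψ(s) + 1/s`). -/
theorem digamma_four : digamma (4 : ℂ) = 11 / 6 - (Real.eulerMascheroniConstant : ℂ) := by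
  have hne : ∀ (x : ℕ), 0 < x → ∀ m : ℕ, ((x : ℂ)) ≠ -(m : ℂ) := by
    intro x hx m h
    have := congrArg Complex.re h
    simp at this
    have : (x : ℝ) = -(m : ℝ) := by exact_mod_cast this
    have hx' : (0 : ℝ) < x := by exact_mod_cast hx
    have hm : (0 : ℝ) ≤ m := by exact_mod_cast Nat.zero_le m
    linarith
  have h1 := Complex.digamma_apply_add_one 1 (by simpa using hne 1 one_pos)
  have h2 := Complex.digamma_apply_add_one 2 (by simpa using hne 2 two_pos)
  have h3 := Complex.digamma_apply_add_one 3 (by simpa using hne 3 (by norm_num))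
  rw [show (4 : ℂ) = 3 + 1 by norm_num, h3, show (3 : ℂ) = 2 + 1 by norm_num, h2,
    show (2 : ℂ) = 1 + 1 by norm_num, h1, Complex.digamma_one]
  norm_num
  ring

/-- **`ξ'/ξ(8)` in closed form up to the prime sum** (RH-FREE):
`ξ'/ξ(8) = 15/56 + 11/12 − γ/2 − ½log π − Σ Λ(n) n⁻⁸`. -/
theorem xiLogDerivRe_eight_zero_eq :
    xiLogDerivRe 8 0 = 15 / 56 + 11 / 12 - Real.eulerMascheroniConstant / 2 - Real.log Real.pi / 2 -
      (L ↗Λ ((8 : ℝ) : ℂ)).re := by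
  rw [xiLogDerivRe_eight_eq]
  have e0 : (4 : ℂ) + (((0 : ℝ) / 2 : ℝ) : ℂ) * I = 4 := by simp
  have e8 : ((8 : ℝ) : ℂ) + ((0 : ℝ) : ℂ) * I = ((8 : ℝ) : ℂ) := by simp
  rw [e0, e8, digamma_four]
  simp only [Complex.sub_re, Complex.ofReal_re]
  norm_num
  ring

/-! ## §2 The prime sum `0 ≤ Σ Λ(n) n⁻⁸ < 0.00317` -/

/-- The real series behind `L Λ 8`: `HasSum (n ↦ Λ(n)/n⁸) (Re L Λ 8)` (with the `n = 0` term `= 0`). -/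
theorem hasSum_vonMangoldt_eight :
    HasSum (fun n : ℕ => if n = 0 then (0 : ℝ) else Λ n / (n : ℝ) ^ (8 : ℝ)) (L ↗Λ ((8 : ℝ) : ℂ)).re := by
  have h := Complex.hasSum_re (ArithmeticFunction.LSeriesSummable_vonMangoldt
    (s := ((8 : ℝ) : ℂ)) (by simp)).hasSum
  refine h.congr_fun fun n => ?_
  rw [term_vonMangoldt_ofReal, Complex.ofReal_re]

/-- `0 ≤ Σ Λ(n) n⁻⁸`. -/
theorem LSeries_vonMangoldt_eight_re_nonneg : 0 ≤ (L ↗Λ ((8 : ℝ) : ℂ)).re :=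
  hasSum_vonMangoldt_eight.nonneg fun n => by
    split_ifs
    · exact le_rfl
    · exact div_nonneg ArithmeticFunction.vonMangoldt_nonneg (by positivity)

/-- The comparison series sums to `log 2/256 + (log 2 + ½)/6561 + (π²/6 − 49/36)/1024`. -/
theorem hasSum_primeSumMajorant :
    HasSum (fun n : ℕ => if n < 4 then (if n = 2 then Real.log 2 / 256 else if n = 3 then (Real.log 2 + 1 / 2) / 6561 else 0)
        else 1 / 1024 * (1 / (n : ℝ) ^ 2))
      (Real.log 2 / 256 + (Real.log 2 + 1 / 2) / 6561 + 1 / 1024 * (Real.pi ^ 2 / 6 - 49 / 36)) := by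
  have hz := hasSum_zeta_two
  -- tail `n ≥ 4` of `Σ n⁻²`
  have htail : HasSum (fun n : ℕ => 1 / ((n + 4 : ℕ) : ℝ) ^ 2) (Real.pi ^ 2 / 6 - 49 / 36) := by
    have h := (hasSum_nat_add_iff' 4).mpr hz
    have hs : ∑ i ∈ Finset.range 4, (1 : ℝ) / (i : ℝ) ^ 2 = 49 / 36 := by
      simp [Finset.sum_range_succ]
      norm_num
    rwa [hs] at h
  have htail' := htail.mul_left (1 / 1024 : ℝ)
  -- reassemble
  refine (hasSum_nat_add_iff' 4).mp ?_
  have hfin : ∑ i ∈ Finset.range 4, (fun n : ℕ => if n < 4 then (if n = 2 then Real.log 2 / 256 else if n = 3 then (Real.log 2 + 1 / 2) / 6561 else 0)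
        else 1 / 1024 * (1 / (n : ℝ) ^ 2)) i =
      Real.log 2 / 256 + (Real.log 2 + 1 / 2) / 6561 := by
    simp [Finset.sum_range_succ]
  rw [hfin]
  have hfun : (fun n : ℕ => (fun n : ℕ => if n < 4 then (if n = 2 then Real.log 2 / 256 else if n = 3 then (Real.log 2 + 1 / 2) / 6561 else 0)
        else 1 / 1024 * (1 / (n : ℝ) ^ 2)) (n + 4)) =
      fun n : ℕ => 1 / 1024 * (1 / ((n + 4 : ℕ) : ℝ) ^ 2) := by
    funext n
    simp
  rw [hfun]
  have e : Real.log 2 / 256 + (Real.log 2 + 1 / 2) / 6561 + 1 / 1024 * (Real.pi ^ 2 / 6 - 49 / 36) -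
      (Real.log 2 / 256 + (Real.log 2 + 1 / 2) / 6561) = 1 / 1024 * (Real.pi ^ 2 / 6 - 49 / 36) := by ring
  rw [e]
  exact htail'

/-- Termwise comparison of `Λ(n)/n⁸` with the comparison series. -/
theorem vonMangoldt_eight_le_majorant (n : ℕ) :
    (if n = 0 then (0 : ℝ) else Λ n / (n : ℝ) ^ (8 : ℝ)) ≤ (fun n : ℕ => if n < 4 then (if n = 2 then Real.log 2 / 256 else if n = 3 then (Real.log 2 + 1 / 2) / 6561 else 0)
        else 1 / 1024 * (1 / (n : ℝ) ^ 2)) n := by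
  have hpow : ∀ m : ℕ, ((m : ℝ)) ^ (8 : ℝ) = (m : ℝ) ^ (8 : ℕ) := fun m => by
    rw [show (8 : ℝ) = ((8 : ℕ) : ℝ) by norm_num, Real.rpow_natCast]
  rcases Nat.lt_or_ge n 4 with hn | hn
  · -- `n ∈ {0,1,2,3}`
    interval_cases n
    · simp
    · simp [ArithmeticFunction.vonMangoldt_apply_one]
    · rw [if_neg (by norm_num), hpow, ArithmeticFunction.vonMangoldt_apply_prime Nat.prime_two]
      simp
      norm_num
    · rw [if_neg (by norm_num), hpow, ArithmeticFunction.vonMangoldt_apply_prime Nat.prime_three]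
      have h3 : Real.log 3 ≤ Real.log 2 + 1 / 2 := by
        have : Real.log 3 = Real.log 2 + Real.log (3 / 2) := by
          rw [← Real.log_mul (by norm_num) (by norm_num)]; norm_num
        rw [this]
        have := Real.log_le_sub_one_of_pos (show (0 : ℝ) < 3 / 2 by norm_num)
        linarith
      norm_num
      rw [div_le_div_iff₀ (by norm_num) (by norm_num)]
      nlinarith
  · -- `n ≥ 4`: `Λ(n)/n⁸ ≤ log n/n⁸ ≤ n/n⁸ = 1/n⁷ ≤ 1/(1024 n²)`
    have hn0 : n ≠ 0 := by omega
    have hnr : (4 : ℝ) ≤ n := by exact_mod_cast hn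
    have hnpos : (0 : ℝ) < n := by linarith
    rw [if_neg hn0, hpow]
    have hmaj : (fun n : ℕ => if n < 4 then (if n = 2 then Real.log 2 / 256 else if n = 3 then (Real.log 2 + 1 / 2) / 6561 else 0)
        else 1 / 1024 * (1 / (n : ℝ) ^ 2)) n =
        1 / 1024 * (1 / (n : ℝ) ^ 2) := by
      simp [show ¬ n < 4 from not_lt.mpr hn]
    rw [hmaj]
    have hΛ : Λ n ≤ (n : ℝ) := by
      have h1 := ArithmeticFunction.vonMangoldt_le_log (n := n)
      have h2 := Real.log_le_sub_one_of_pos hnpos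
      linarith
    have h5 : (1024 : ℝ) ≤ (n : ℝ) ^ 5 := by
      have := pow_le_pow_left₀ (by norm_num : (0 : ℝ) ≤ 4) hnr 5
      norm_num at this
      exact this
    calc Λ n / (n : ℝ) ^ 8 ≤ (n : ℝ) / (n : ℝ) ^ 8 := by gcongr
      _ = 1 / ((n : ℝ) ^ 5 * (n : ℝ) ^ 2) := by field_simp
      _ ≤ 1 / (1024 * (n : ℝ) ^ 2) := by gcongr
      _ = 1 / 1024 * (1 / (n : ℝ) ^ 2) := by ring

/-- **`Σ Λ(n) n⁻⁸ < 0.00317`** (RH-FREE numerics). -/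
theorem LSeries_vonMangoldt_eight_re_le : (L ↗Λ ((8 : ℝ) : ℂ)).re ≤ 0.00317 := by
  have h := hasSum_le vonMangoldt_eight_le_majorant hasSum_vonMangoldt_eight hasSum_primeSumMajorant
  have h2 := Real.log_two_lt_d9
  have hπ := Real.pi_lt_d6
  have hπ0 := Real.pi_pos
  have hπ2 : Real.pi ^ 2 < 9.8697 := by nlinarith
  linarith

/-! ## §3 The enclosure of `ξ'/ξ(8)` and the numerical clean radius -/

/-- **`0.3203 ≤ ξ'/ξ(8) ≤ 0.3236`** (RH-FREE; true value `0.32066…`). -/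
theorem xiLogDerivRe_eight_zero_bounds : 0.3203 ≤ xiLogDerivRe 8 0 ∧ xiLogDerivRe 8 0 ≤ 0.3236 := by
  rw [xiLogDerivRe_eight_zero_eq]
  have hγ₁ := Real.eulerMascheroniConstant_gt_d8
  have hγ₂ := Real.eulerMascheroniConstant_lt_d8
  have hπ₁ := Real.log_pi_lt_d20
  have hπ₂ := Real.log_pi_gt_d20
  have hL₁ := LSeries_vonMangoldt_eight_re_nonneg
  have hL₂ := LSeries_vonMangoldt_eight_re_le
  constructor <;> linarith

/-- **NUMERICAL LINEAR CLEAN RADIUS `0.0427`** (RH-FREE, unconditional): for every `c ≤ 0.0427` there is `θ₁` such that for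
all `θ ≥ θ₁` every window `0 ≤ t ≤ cθ` of `𝖪_θ` carries no eigenvalue `±1` (since `0.0427 < (2/15)·0.3203 ≤ (2/15)·ξ'/ξ(8)`). -/
theorem linear_clean_radius_0427 :
    ∀ c : ℝ, c ≤ 0.0427 → ∃ θ₁ : ℝ, ∀ θ : ℝ, θ₁ ≤ θ → CleanUpTo θ (c * θ) := by
  intro c hc
  have hb := xiLogDerivRe_eight_zero_bounds.1
  refine linear_clean_radius_eight c (lt_of_le_of_lt hc ?_)
  rw [lt_div_iff₀ (by norm_num)]
  linarith

/-- In particular (RH-FREE): for all large `θ`, EVERY WINDOW `t ≤ θ/25` of Suzuki's single operator `𝖪_θ` is free of the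
eigenvalues `±1`. -/
theorem clean_up_to_div_25 : ∃ θ₁ : ℝ, ∀ θ : ℝ, θ₁ ≤ θ → CleanUpTo θ (θ / 25) := by
  obtain ⟨θ₁, h⟩ := linear_clean_radius_0427 (1 / 25) (by norm_num)
  exact ⟨θ₁, fun θ hθ => by simpa [div_eq_inv_mul, one_div] using h θ hθ⟩


/-! ## §4 The results in the named forms of `Theorems.SuzukiSharpRadiusDefs` -/

/-- S3′ in its named form: `SaddleHeightBoundAt` HOLDS (RH-FREE). -/
theorem saddleHeightBoundAt : SaddleHeightBoundAt := fun θ₀ hθ₀ b hb => by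
  obtain ⟨C, _, hC⟩ := saddle_height_bound_at hθ₀ hb
  exact ⟨C, hC⟩

/-- The typed (uniform) `SaddleHeightBound` implies its fixed-line form (pure logic). -/
theorem saddleHeightBoundAt_of_saddleHeightBound (h : SaddleHeightBound) : SaddleHeightBoundAt :=
  fun θ₀ hθ₀ b hb => by
    obtain ⟨C, hC⟩ := h θ₀ hθ₀ b hb
    exact ⟨C, fun θ hθ m hm x => hC θ hθ b hb le_rfl m hm x⟩

/-- `LinearCleanRadiusSharp` is literally `LinearCleanRadiusBelow c⋆`. -/
theorem linearCleanRadiusSharp_iff : LinearCleanRadiusSharp ↔ LinearCleanRadiusBelow sharpCleanConst := Iff.rfl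

/-- `XiLogDerivMinOnAxis` is `XiLogDerivMinOnAxisAt σ` for every `σ ∈ (1, 2]`. -/
theorem xiLogDerivMinOnAxis_iff :
    XiLogDerivMinOnAxis ↔ ∀ σ : ℝ, 1 < σ → σ ≤ 2 → XiLogDerivMinOnAxisAt σ :=
  ⟨fun h σ h1 h2 u => h σ u h1 h2, fun h σ u h1 h2 => h σ h1 h2 u⟩

/-- Monotonicity of `LinearCleanRadiusBelow` in the threshold. -/
theorem LinearCleanRadiusBelow.mono {a b : ℝ} (hab : a ≤ b) (h : LinearCleanRadiusBelow b) :
    LinearCleanRadiusBelow a := fun c hc => h c (lt_of_lt_of_le hc hab)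

/-- The window mechanism in named form (RH-FREE): a one-line minimum at `σ > 1` makes every
`c < ξ'/ξ(σ)/(σ − ½)` a linear clean radius. -/
theorem linearCleanRadiusBelow_of_minOnAxisAt {σ : ℝ} (hσ : 1 < σ) (h : XiLogDerivMinOnAxisAt σ) :
    LinearCleanRadiusBelow (xiLogDerivRe σ 0 / (σ - 1 / 2)) :=
  linear_clean_radius_of_line_min hσ h

/-- **RUNG 1, named** (RH-FREE, unconditional): `XiLogDerivMinOnAxisAt 8`. -/
theorem xiLogDerivMinOnAxisAt_eight : XiLogDerivMinOnAxisAt 8 := xiLogDerivRe_eight_min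

/-- **RUNG 1 radius, named** (RH-FREE, unconditional): `LinearCleanRadiusBelow ((2/15)·ξ'/ξ(8))`. -/
theorem linearCleanRadiusBelow_eight : LinearCleanRadiusBelow (xiLogDerivRe 8 0 / (8 - 1 / 2)) :=
  linear_clean_radius_eight

/-- **Numerical, named** (RH-FREE, unconditional): `LinearCleanRadiusBelow 0.0427`. -/
theorem linearCleanRadiusBelow_0427 : LinearCleanRadiusBelow 0.0427 := fun c hc =>
  linear_clean_radius_0427 c hc.le


/-- **Weakest form of the reduction** (RH-FREE): it suffices that the one-line minimum `XiLogDerivMinOnAxisAt σ` holds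
FREQUENTLY as `σ ↓ 1` (e.g. along any sequence `σ_n ↓ 1`), not on the whole interval `(1, 2]`. -/
theorem linearCleanRadiusSharp_of_frequently_minOnAxisAt
    (h : ∃ᶠ σ in 𝓝[>] (1 : ℝ), XiLogDerivMinOnAxisAt σ) : LinearCleanRadiusSharp := by
  intro c hc
  rw [sharpCleanConst_eq_two_mul] at hc
  have hg : ContinuousAt (fun σ : ℝ => xiLogDerivRe σ 0 / (σ - 1 / 2)) 1 :=
    continuousAt_xiLogDerivRe_one.div ((continuous_id.sub continuous_const).continuousAt) (by norm_num)
  have hg1 : c < (fun σ : ℝ => xiLogDerivRe σ 0 / (σ - 1 / 2)) 1 := by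
    show c < xiLogDerivRe 1 0 / (1 - 1 / 2)
    rw [show (1 : ℝ) - 1 / 2 = 1 / 2 by norm_num, div_eq_mul_inv, show ((1 : ℝ) / 2)⁻¹ = 2 by norm_num]
    linarith
  have hev : ∀ᶠ σ : ℝ in 𝓝 1, c < xiLogDerivRe σ 0 / (σ - 1 / 2) := hg.eventually (eventually_gt_nhds hg1)
  have hev' : ∀ᶠ σ : ℝ in 𝓝[>] 1, c < xiLogDerivRe σ 0 / (σ - 1 / 2) := hev.filter_mono nhdsWithin_le_nhds
  have hev3 : ∀ᶠ σ : ℝ in 𝓝[>] 1, σ ∈ Ioi (1 : ℝ) := eventually_mem_nhdsWithin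
  obtain ⟨σ, hmin, hcσ, hσ1⟩ := (h.and_eventually (hev'.and hev3)).exists
  rw [mem_Ioi] at hσ1
  exact linear_clean_radius_of_line_min hσ1 hmin c hcσ

end Summit.RiemannHypothesis.RiemannHypothesis.Theorems.SuzukiSharpRadius

end
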